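import Mathlib.Analysis.Calculus.InverseFunctionTheorem.FDeriv
import Mathlib.Analysis.Calculus.ContDiff.RCLike
import Mathlib.Topology.DiscreteSubset
import HarnessLib

/-!
# Transversal zeros are isolated, hence finite on compact sets

Topic `Literature/Topology/FourManifolds` (programme of the fact
`Literature.Topology.FourManifolds.exists_isSimplifiedBrokenLefschetzFibration`, Baykur–Saeki 2017, §2.1
p. 6: once two pieces of fold image cross transversally, their crossings are finitely many, so
the set of crossing values to be avoided by the later pushes is countable).  If `Φ` is `C¹`
near a compact set `K` and `dΦ(z)` is invertible at every zero `z ∈ K` of `Φ`, then `Φ` has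
only finitely many zeros in `K`: by the inverse function theorem `Φ` is injective near each
such zero, so the zero set is discrete, and a compact discrete set is finite.

* `eventually_ne_of_hasStrictFDerivAt`, `finite_zeros_of_fderiv_bijective`.

Everything is proved; no definitions, no named facts (D-0026).

## References

* R. İ. Baykur, O. Saeki, *Simplifying indefinite fibrations on 4-manifolds*, arXiv:1705.11169,
  §2.1, p. 6. [BaykurSaeki2017]
* M. W. Hirsch, *Differential Topology*, GTM 33 (1976), Ch. 1 §3 (regular values), Ch. 3 §2.
  [HirschDT1976]
-/

noncomputable section

open Set Function Filter
open scoped Topology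

namespace Literature.Topology.FourManifolds

variable {E F : Type*} [NormedAddCommGroup E] [NormedSpace ℝ E] [CompleteSpace E]
  [NormedAddCommGroup F] [NormedSpace ℝ F] [CompleteSpace F]

omit [CompleteSpace F] in
/-- A map with invertible strict derivative at `a` takes the value `Φ a` only at `a`, near `a`.
[cite: HirschDT1976, Ch. 1 §3] -/
theorem eventually_ne_of_hasStrictFDerivAt {Φ : E → F} {Φ' : E ≃L[ℝ] F} {a : E}
    (h : HasStrictFDerivAt Φ (Φ' : E →L[ℝ] F) a) : ∀ᶠ x in 𝓝 a, x ≠ a → Φ x ≠ Φ a := by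
  filter_upwards [h.eventually_left_inverse] with x hx hxa heq
  apply hxa
  rw [← hx, heq, h.localInverse_apply_image]

/-- **Transversal zeros are finite on compact sets.**  Let `Φ : E → F` be `C¹` on the open
set `O ⊇ K`, `K` compact, with `dΦ(z)` bijective at every zero `z ∈ K`.  Then
`{z ∈ K | Φ z = 0}` is finite. [cite: HirschDT1976, Ch. 1 §3] [cite: BaykurSaeki2017, §2.1, p. 6] -/
theorem finite_zeros_of_fderiv_bijective [T2Space E] {Φ : E → F} {O K : Set E} (hO : IsOpen O)
    (hΦ : ContDiffOn ℝ 1 Φ O) (hK : IsCompact K) (hKO : K ⊆ O)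
    (htr : ∀ z ∈ K, Φ z = 0 → Bijective (fderiv ℝ Φ z)) :
    {z ∈ K | Φ z = 0}.Finite := by
  set Z : Set E := {z ∈ K | Φ z = 0} with hZ
  -- `Z` is compact
  have hZcl : IsClosed Z := by
    have := (hΦ.continuousOn.mono hKO).preimage_isClosed_of_isClosed hK.isClosed isClosed_singleton
      (t := {(0 : F)})
    simpa [hZ, preimage, setOf_and] using this
  have hZc : IsCompact Z := hK.of_isClosed_subset hZcl fun z hz => hz.1
  -- `Z` is discrete
  have hdisc : IsDiscrete Z := by
    rw [isDiscrete_iff_forall_mem_exists_isOpen]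
    rintro z ⟨hzK, hz0⟩
    have hbij := htr z hzK hz0
    set L : E ≃L[ℝ] F := ContinuousLinearEquiv.ofBijective (fderiv ℝ Φ z)
      (LinearMap.ker_eq_bot.2 hbij.1) (LinearMap.range_eq_top.2 hbij.2) with hL
    have hstrict : HasStrictFDerivAt Φ (L : E →L[ℝ] F) z := by
      rw [hL, ContinuousLinearEquiv.coe_ofBijective]
      exact (hΦ.contDiffAt (hO.mem_nhds (hKO hzK))).hasStrictFDerivAt one_ne_zero
    obtain ⟨u, hu, huo, hzu⟩ := eventually_nhds_iff.1 (eventually_ne_of_hasStrictFDerivAt hstrict)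
    refine ⟨u, huo, ?_⟩
    ext x
    simp only [mem_inter_iff, mem_singleton_iff, hZ, mem_setOf_eq]
    constructor
    · rintro ⟨hxu, -, hx0⟩
      by_contra hxz
      exact hu x hxu hxz (by rw [hx0, hz0])
    · rintro rfl
      exact ⟨hzu, hzK, hz0⟩
  exact hZc.finite hdisc

end Literature.Topology.FourManifolds
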